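import Literature.Probability.RandomPlanarGeometry.SAWPulledLargeForceExpansionZdNineStepCellsSq
import Literature.Probability.RandomPlanarGeometry.SAWPulledLargeForceExpansionZdNineStepCellsHx
import Literature.Probability.RandomPlanarGeometry.SAWPulledLargeForceExpansionZdNineStepCellsOct
import Literature.Probability.RandomPlanarGeometry.SAWIrreducibleBridgeSpanOne
import Literature.Probability.RandomPlanarGeometry.SAWPulledLargeForceExpansionZdEightStep
import Literature.Probability.RandomPlanarGeometry.SAWCountStepWords
import HarnessLib

/-!
# The pulled self-avoiding walk on `ℤ^{d+1}` at large force: the cost-eight irreducible bridges of length nine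
# (`N_{8,9} = c₈(ℤ^d) = 256d⁸ − 896d⁷ + 1024d⁶ − 416d⁵ + 320d⁴ + 424d³ − 2124d² + 1414d` in every dimension)

Topic `Literature/Probability/RandomPlanarGeometry` («ZD-NINE-STEP»).  By `SAWIrreducibleBridgeSpanOne` the cost-`c` irreducible bridges of length
`c + 1` on `ℤ^{d+1}` are the `c`-step self-avoiding walks of `ℤ^d` (`costCoeffZd_self_succ : N_{c,c+1} = count d c`), and by `SAWCountStepWords`
those are counted by the self-avoiding STEP WORDS (`card_sawWords_eq_count`).  This file counts the self-avoiding words of length 8 by their last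
letter: a word `(u, x)` is self-avoiding iff `u` is (`SAW7 u`, the twelve even blocks of `…ZdWordTypesSeven`) and the new letter `x` closes none of
the four even tails — it is not the reversal of `u₆` and does not close a square, a hexagon or an octagon; for a self-avoiding `u` these four
events are disjoint, the first always has one `x`, and the others have one `x` exactly when the last three / five / seven letters of `u` sum to a
unit vector (`UnitTail3/5/7 u`).  Hence ★ `card_sawWords_eight_add`:
`#sawWords d 8 + #SAW7 + #Sq + #Hx + #Oct = 2d · #SAW7`, and with `#SAW7 = count d 7` (`isSAW_iff_saw7`; the tree's `c₇(ℤ^d)` of `…ZdEightStep`) and the three closer censuses of the cells files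
(`card_sq7`, `card_hx7`, `card_oct7`) ★★ `count_eight_add` / `count_eight`: `c₈(ℤ^d) = 256d⁸ − 896d⁷ + 1024d⁶ − 416d⁵ + 320d⁴ + 424d³ − 2124d² + 1414d` for every `d`
(lane values `d = 1, 2, 3`: `2`, `5 916`, `387 966`) and ★★ `costCoeffZd_eight_nine`: `N_{8,9}(ℤ^{d+1}) = c₈(ℤ^d)`.  (The companion cells file `…ZdNineStepCellsSaw` re-derives `c₇(ℤ^d)` itself by axis types: `card_saw7`.)
Generic lemmas: `twoStepV_eq_cons`, `wordPos_eq_add_sum`, ★ `isSAW_iff_blocks` (a step word is self-avoiding iff no block of steps sums to zero),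
`bsumW_ne_zero_of_odd` (odd blocks never vanish: parity), ★ `isSAW_iff_even_blocks`, `exists_mem_eq_of_sum_eq_twoStepV` (if unit steps sum to a unit
step then one of them is that step), ★ `exists_close_iff`.
Attribution: the number of `n`-step self-avoiding walks of `ℤ^d` as a polynomial in `d` is classical print (Fisher–Gaunt 1964; Clisby–Liang–Slade 2007;
`c₈(ℤ²) = 5 916`, `c₈(ℤ³) = 387 966` are entries of [MadrasSlade1993, Appendix C, Table C.1], cited as a locator only); the file takes no number from
print and claims no novelty for the polynomial — the lane's object is the cost census `N_{8,9}` of the large-force expansion and the closer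
decomposition behind it (CONJECTURE (20) of FINDING-PULLED-LARGE-FORCE, now a theorem).  The definitions `bsumW`, `snocEquiv7` are this file's tool notions (not
notions in print).

Provenance: lane «pcv-sawmu», a-p3 g19 (2026-08-26).
-/

noncomputable section

open Finset
open scoped BigOperators
open Literature.Probability.LatticeModels
open Literature.Probability.RandomPlanarGeometry.SAW

namespace Literature.Probability.RandomPlanarGeometry.SAW.Zd

namespace WordTypes

variable {d : ℕ}

/-! ### Step words: self-avoidance is the non-vanishing of the block sums -/

/-- The block sum `Σ_{i ≤ p < j} v(w p)` of a word of any length (transverse embedding `twoStepV`). [cite: MadrasSlade1993, Definition 1.2.4] -/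
def bsumW {n : ℕ} (w : Word n d) (i j : ℕ) : Site (d + 1) :=
  ∑ p ∈ Finset.univ.filter (fun p : Fin n => i ≤ p.val ∧ p.val < j), twoStepV d (w p)

/-- The transverse embedding of a letter is its step vector behind a zero height coordinate. [cite: MadrasSlade1993, Definition 1.2.4] -/
theorem twoStepV_eq_cons (s : Idx d) : twoStepV d s = Fin.cons 0 (Percolation.stepVec s) := by
  obtain ⟨j, b⟩ := s
  cases b
  · rw [twoStepV, Percolation.stepVec]
    simp only [Bool.false_eq_true, ↓reduceIte]
    rw [← Pi.single_neg, single_succ_eq_cons]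
  · rw [twoStepV, Percolation.stepVec]
    simp only [↓reduceIte]
    rw [single_succ_eq_cons]

/-- `Fin.cons 0 0 = 0` in `Site (d+1)`. [cite: MadrasSlade1993, Definition 1.2.4] -/
theorem cons_zero_zero' : (Fin.cons (0 : ℤ) (0 : Site d) : Site (d + 1)) = 0 := by
  funext i
  refine Fin.cases ?_ (fun j => ?_) i
  · rfl
  · simp [Fin.cons_succ]

/-- Sums of transverse embeddings are the embedded sums. [cite: MadrasSlade1993, Definition 1.2.4] -/
theorem sum_twoStepV_eq_cons {ι : Type*} (S : Finset ι) (f : ι → Idx d) :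
    ∑ p ∈ S, twoStepV d (f p) = Fin.cons 0 (∑ p ∈ S, Percolation.stepVec (f p)) := by
  classical
  induction S using Finset.induction_on with
  | empty => simp only [Finset.sum_empty]; exact cons_zero_zero'.symm
  | insert a S ha ih => rw [Finset.sum_insert ha, Finset.sum_insert ha, ih, twoStepV_eq_cons, cons_add_cons, zero_add]

/-- A transverse sum vanishes iff the sum of step vectors does. [cite: MadrasSlade1993, Definition 1.2.4] -/
theorem sum_twoStepV_eq_zero_iff_stepVec {ι : Type*} (S : Finset ι) (f : ι → Idx d) :
    ∑ p ∈ S, twoStepV d (f p) = 0 ↔ ∑ p ∈ S, Percolation.stepVec (f p) = 0 := by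
  rw [sum_twoStepV_eq_cons]
  constructor
  · intro h
    have := congrArg Fin.tail h
    rw [Fin.tail_cons] at this
    exact this
  · intro h
    rw [h]
    exact cons_zero_zero'

/-- Positions along a step word differ by block sums of step vectors. [cite: MadrasSlade1993, Definition 1.2.4] -/
theorem wordPos_eq_add_sum {n : ℕ} (w : Word n d) {i j : ℕ} (hij : i ≤ j) (hj : j ≤ n) :
    Percolation.wordPos w j = Percolation.wordPos w i + ∑ p ∈ Finset.univ.filter (fun p : Fin n => i ≤ p.val ∧ p.val < j), Percolation.stepVec (w p) := by
  induction j, hij using Nat.le_induction with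
  | base =>
    have : (Finset.univ.filter fun p : Fin n => i ≤ p.val ∧ p.val < i) = ∅ :=
      Finset.filter_eq_empty_iff.2 fun p _ h => absurd (lt_of_le_of_lt h.1 h.2) (lt_irrefl _)
    rw [this, Finset.sum_empty, add_zero]
  | succ k hik ih =>
    have hk : k < n := Nat.lt_of_succ_le hj
    rw [Percolation.wordPos_succ w hk, ih hk.le]
    have hsplit : (Finset.univ.filter fun p : Fin n => i ≤ p.val ∧ p.val < k + 1) =
        insert (⟨k, hk⟩ : Fin n) (Finset.univ.filter fun p : Fin n => i ≤ p.val ∧ p.val < k) := by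
      ext p
      simp only [Finset.mem_filter, Finset.mem_univ, true_and, Finset.mem_insert, Fin.ext_iff]
      constructor
      · rintro ⟨h1, h2⟩
        by_cases hp : p.val = k
        · exact Or.inl hp
        · exact Or.inr ⟨h1, by omega⟩
      · rintro (h | ⟨h1, h2⟩)
        · exact ⟨by simp only [h]; exact hik, by omega⟩
        · exact ⟨h1, by omega⟩
    have hnot : (⟨k, hk⟩ : Fin n) ∉ Finset.univ.filter fun p : Fin n => i ≤ p.val ∧ p.val < k := by
      simp
    rw [hsplit, Finset.sum_insert hnot]
    abel

/-- Two positions of a step word coincide iff the block of steps between them sums to zero. [cite: MadrasSlade1993, Definition 1.2.4] -/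
theorem wordPos_eq_iff_bsumW {n : ℕ} (w : Word n d) {i j : ℕ} (hij : i ≤ j) (hj : j ≤ n) :
    Percolation.wordPos w i = Percolation.wordPos w j ↔ bsumW w i j = 0 := by
  rw [bsumW, sum_twoStepV_eq_zero_iff_stepVec, wordPos_eq_add_sum w hij hj]
  constructor
  · intro h; exact (add_eq_left.1 h.symm)
  · intro h; rw [h, add_zero]

/-- ★ A step word is self-avoiding iff no block of its steps sums to zero. [cite: MadrasSlade1993, Definition 1.2.4] -/
theorem isSAW_iff_blocks {n : ℕ} (w : Word n d) : Percolation.IsSAW w ↔ ∀ i j : ℕ, i < j → j ≤ n → bsumW w i j ≠ 0 := by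
  constructor
  · intro h i j hij hj hb
    have := h i j (by omega) hj ((wordPos_eq_iff_bsumW w hij.le hj).2 hb)
    omega
  · intro h i j hi hj hEq
    rcases lt_trichotomy i j with hlt | heq | hgt
    · exact absurd ((wordPos_eq_iff_bsumW w hlt.le hj).1 hEq) (h i j hlt hj)
    · exact heq
    · exact absurd ((wordPos_eq_iff_bsumW w hgt.le hi).1 hEq.symm) (h j i hgt hi)

/-- The number of steps in the block `[i, j)` is `j − i` (`j ≤ n`). [cite: MadrasSlade1993, Definition 1.2.4] -/
theorem card_block {n : ℕ} {i j : ℕ} (hj : j ≤ n) :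
    (Finset.univ.filter fun p : Fin n => i ≤ p.val ∧ p.val < j).card = j - i := by
  rw [← Finset.card_image_of_injective _ Fin.val_injective]
  have : (Finset.univ.filter fun p : Fin n => i ≤ p.val ∧ p.val < j).image Fin.val = Finset.Ico i j := by
    ext m
    simp only [Finset.mem_image, Finset.mem_filter, Finset.mem_univ, true_and, Finset.mem_Ico]
    constructor
    · rintro ⟨p, ⟨h1, h2⟩, rfl⟩; exact ⟨h1, h2⟩
    · rintro ⟨h1, h2⟩; exact ⟨⟨m, by omega⟩, ⟨h1, h2⟩, rfl⟩
  rw [this, Nat.card_Ico]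

/-- The coordinate sum of a block sum has the parity of the number of steps. [cite: MadrasSlade1993, Definition 1.2.4] -/
theorem exists_csum_bsumW {n : ℕ} (w : Word n d) (i j : ℕ) :
    ∃ k : ℤ, ∑ c, bsumW w i j c = 2 * k + (Finset.univ.filter fun p : Fin n => i ≤ p.val ∧ p.val < j).card := by
  classical
  unfold bsumW
  generalize (Finset.univ.filter fun p : Fin n => i ≤ p.val ∧ p.val < j) = S
  induction S using Finset.induction_on with
  | empty => exact ⟨0, by simp⟩
  | insert a S ha ih =>
    obtain ⟨k, hk⟩ := ih
    obtain ⟨m, hm⟩ := exists_sum_twoStepV_eq d (w a)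
    refine ⟨k + m, ?_⟩
    rw [Finset.sum_insert ha, Finset.card_insert_of_notMem ha]
    simp only [Pi.add_apply, Finset.sum_add_distrib, hm, hk]
    push_cast
    ring

/-- Odd blocks never vanish. [cite: MadrasSlade1993, Definition 1.2.4] -/
theorem bsumW_ne_zero_of_odd {n : ℕ} (w : Word n d) {i j : ℕ} (hj : j ≤ n) (hodd : (j - i) % 2 = 1) :
    bsumW w i j ≠ 0 := by
  intro h
  obtain ⟨k, hk⟩ := exists_csum_bsumW w i j
  rw [h, card_block hj] at hk
  simp only [Pi.zero_apply, Finset.sum_const_zero] at hk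
  omega

/-- ★ A step word is self-avoiding iff no EVEN block of its steps sums to zero. [cite: MadrasSlade1993, Definition 1.2.4] -/
theorem isSAW_iff_even_blocks {n : ℕ} (w : Word n d) :
    Percolation.IsSAW w ↔ ∀ i j : ℕ, i < j → j ≤ n → (j - i) % 2 = 0 → bsumW w i j ≠ 0 := by
  rw [isSAW_iff_blocks]
  constructor
  · exact fun h i j hij hj _ => h i j hij hj
  · intro h i j hij hj
    by_cases he : (j - i) % 2 = 0
    · exact h i j hij hj he
    · exact bsumW_ne_zero_of_odd w hj (by omega)

/-! ### Length seven and the last letter of length eight -/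

/-- The block sums of `…ZdWordTypesSeven` are `bsumW` at length 7. [cite: MadrasSlade1993, Definition 1.2.4] -/
theorem bsum7_eq_bsumW (u : Word 7 d) (i j : ℕ) : bsum7 u i j = bsumW u i j := rfl

/-- Even blocks at length 7, spelled out: `SAW7`. [cite: MadrasSlade1993, §4.2, remark after Theorem 4.2.4 (p. 94)] -/
theorem even_blocks7_iff (u : Word 7 d) : (∀ i j : ℕ, i < j → j ≤ 7 → (j - i) % 2 = 0 → bsumW u i j ≠ 0) ↔ SAW7 u := by
  constructor
  · intro h
    exact ⟨h 0 2 (by norm_num) (by norm_num) (by norm_num), h 1 3 (by norm_num) (by norm_num) (by norm_num),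
      h 2 4 (by norm_num) (by norm_num) (by norm_num), h 3 5 (by norm_num) (by norm_num) (by norm_num),
      h 4 6 (by norm_num) (by norm_num) (by norm_num), h 5 7 (by norm_num) (by norm_num) (by norm_num),
      h 0 4 (by norm_num) (by norm_num) (by norm_num), h 1 5 (by norm_num) (by norm_num) (by norm_num),
      h 2 6 (by norm_num) (by norm_num) (by norm_num), h 3 7 (by norm_num) (by norm_num) (by norm_num),
      h 0 6 (by norm_num) (by norm_num) (by norm_num), h 1 7 (by norm_num) (by norm_num) (by norm_num)⟩
  · rintro ⟨h02, h13, h24, h35, h46, h57, h04, h15, h26, h37, h06, h17⟩ i j hij hj he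
    rw [← bsum7_eq_bsumW] at *
    interval_cases j <;> interval_cases i <;> first | assumption | (exfalso; omega)

/-- ★ Self-avoiding step words of length 7 are the words of class `SAW7`. [cite: MadrasSlade1993, §4.2, remark after Theorem 4.2.4 (p. 94)] -/
theorem isSAW_iff_saw7 (u : Word 7 d) : Percolation.IsSAW u ↔ SAW7 u := by
  rw [isSAW_iff_even_blocks, even_blocks7_iff]

/-- Blocks of `(u, x)` inside the first seven letters are blocks of `u`. [cite: MadrasSlade1993, Definition 1.2.4] -/
theorem bsumW_snoc_of_le (u : Word 7 d) (x : Idx d) {i j : ℕ} (hj : j ≤ 7) :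
    bsumW (Fin.snoc u x : Word 8 d) i j = bsumW u i j := by
  unfold bsumW
  rw [Finset.sum_filter, Finset.sum_filter, Fin.sum_univ_castSucc]
  simp only [Fin.val_castSucc, Fin.snoc_castSucc, Fin.val_last]
  rw [if_neg (by omega), add_zero]

/-- The tail blocks of `(u, x)` are the tails of `u` plus the new step. [cite: MadrasSlade1993, Definition 1.2.4] -/
theorem bsumW_snoc_eight (u : Word 7 d) (x : Idx d) {i : ℕ} (hi : i ≤ 7) :
    bsumW (Fin.snoc u x : Word 8 d) i 8 = bsumW u i 7 + twoStepV d x := by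
  unfold bsumW
  rw [Finset.sum_filter, Finset.sum_filter, Fin.sum_univ_castSucc]
  simp only [Fin.val_castSucc, Fin.snoc_castSucc, Fin.val_last, Fin.snoc_last]
  rw [if_pos ⟨hi, by norm_num⟩]
  congr 1
  refine Finset.sum_congr rfl fun p _ => ?_
  have hp := p.is_lt
  by_cases h : i ≤ p.val
  · rw [if_pos ⟨h, by omega⟩, if_pos ⟨h, hp⟩]
  · rw [if_neg (fun hh => h hh.1), if_neg (fun hh => h hh.1)]

/-- ★ THE LAST LETTER: `(u, x)` is self-avoiding iff `u` is and `x` closes none of the four even tails.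
[cite: MadrasSlade1993, §4.2, remark after Theorem 4.2.4 (p. 94)] -/
theorem isSAW_snoc_iff (u : Word 7 d) (x : Idx d) :
    Percolation.IsSAW (Fin.snoc u x : Word 8 d) ↔ SAW7 u ∧ bsumW u 6 7 + twoStepV d x ≠ 0 ∧ bsumW u 4 7 + twoStepV d x ≠ 0 ∧
      bsumW u 2 7 + twoStepV d x ≠ 0 ∧ bsumW u 0 7 + twoStepV d x ≠ 0 := by
  rw [isSAW_iff_even_blocks]
  constructor
  · intro h
    refine ⟨(even_blocks7_iff u).1 fun i j hij hj he => ?_, ?_, ?_, ?_, ?_⟩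
    · have := h i j hij (by omega) he
      rwa [bsumW_snoc_of_le u x hj] at this
    · have := h 6 8 (by norm_num) (by norm_num) (by norm_num); rwa [bsumW_snoc_eight u x (by norm_num)] at this
    · have := h 4 8 (by norm_num) (by norm_num) (by norm_num); rwa [bsumW_snoc_eight u x (by norm_num)] at this
    · have := h 2 8 (by norm_num) (by norm_num) (by norm_num); rwa [bsumW_snoc_eight u x (by norm_num)] at this
    · have := h 0 8 (by norm_num) (by norm_num) (by norm_num); rwa [bsumW_snoc_eight u x (by norm_num)] at this
  · rintro ⟨h7, t6, t4, t2, t0⟩ i j hij hj he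
    have h7' := (even_blocks7_iff u).2 h7
    rcases Nat.lt_or_ge j 8 with hj8 | hj8
    · rw [bsumW_snoc_of_le u x (by omega)]
      exact h7' i j hij (by omega) he
    · have hj' : j = 8 := by omega
      subst hj'
      rw [bsumW_snoc_eight u x (by omega)]
      have : i = 0 ∨ i = 2 ∨ i = 4 ∨ i = 6 := by omega
      rcases this with rfl | rfl | rfl | rfl
      exacts [t0, t2, t4, t6]

/-! ### Closing a tail: one letter left over -/

/-- If unit steps sum to a unit step, one of them is that step. [cite: MadrasSlade1993, Definition 1.2.4] -/
theorem exists_mem_eq_of_sum_eq_twoStepV {ι : Type*} (S : Finset ι) (f : ι → Idx d) (y : Idx d)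
    (h : ∑ p ∈ S, twoStepV d (f p) = twoStepV d y) : ∃ p ∈ S, f p = y := by
  classical
  by_contra hne
  push Not at hne
  -- coordinate `y.1.succ`: every step on the axis of `y` has the opposite sign `−sgnV y`
  have hc := congrFun h y.1.succ
  rw [Finset.sum_apply] at hc
  have hterm : ∀ p ∈ S, twoStepV d (f p) y.1.succ = if y.1 = (f p).1 then -sgnV y else 0 := by
    intro p hp
    rw [twoStepV_apply_succ]
    by_cases hax : y.1 = (f p).1
    · rw [if_pos hax, if_pos hax]
      have hsg : (f p).2 ≠ y.2 := fun hs => hne p hp (Prod.ext hax.symm hs)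
      unfold sgnV
      cases hy : y.2 <;> cases hf : (f p).2 <;> simp_all
    · rw [if_neg hax, if_neg hax]
  rw [Finset.sum_congr rfl hterm, Finset.sum_ite, Finset.sum_const_zero, add_zero, Finset.sum_const, twoStepV_apply_succ,
    if_pos rfl, smul_neg, nsmul_eq_mul] at hc
  -- `-(k · σ) = σ` with `σ = ±1` is impossible for a natural `k`
  have hs : sgnV y = 1 ∨ sgnV y = -1 := by unfold sgnV; split_ifs <;> simp
  set k := (S.filter fun p => y.1 = (f p).1).card
  rcases hs with hs | hs <;> rw [hs] at hc <;> omega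

/-- ★ A tail can be closed by one more step iff one of its letters is left over while the others cancel; the closing step is then the
reversal of the left-over letter. [cite: MadrasSlade1993, §4.2, remark after Theorem 4.2.4 (p. 94)] -/
theorem exists_close_iff {ι : Type*} [DecidableEq ι] (S : Finset ι) (f : ι → Idx d) :
    (∃ x : Idx d, ∑ p ∈ S, twoStepV d (f p) + twoStepV d x = 0) ↔ ∃ p ∈ S, ∑ q ∈ S.erase p, twoStepV d (f q) = 0 := by
  constructor
  · rintro ⟨x, hx⟩
    have hsum : ∑ p ∈ S, twoStepV d (f p) = twoStepV d (revIdx x) := by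
      rw [twoStepV_revIdx, ← sub_eq_zero, sub_neg_eq_add, hx]
    obtain ⟨p, hp, hfp⟩ := exists_mem_eq_of_sum_eq_twoStepV S f (revIdx x) hsum
    refine ⟨p, hp, ?_⟩
    rw [Finset.sum_erase_eq_sub hp, hsum, hfp, sub_self]
  · rintro ⟨p, hp, h0⟩
    refine ⟨revIdx (f p), ?_⟩
    rw [← Finset.add_sum_erase S _ hp, h0, add_zero, twoStepV_revIdx, add_neg_cancel]

/-- The closing step of a tail is unique: at most one `x`. [cite: MadrasSlade1993, Definition 1.2.4] -/
theorem card_filter_close_le_one (v : Site (d + 1)) : (Finset.univ.filter fun x : Idx d => v + twoStepV d x = 0).card ≤ 1 := by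
  refine Finset.card_le_one.2 fun x hx y hy => ?_
  rw [Finset.mem_filter] at hx hy
  apply twoStepV_injective d
  have h1 := hx.2
  have h2 := hy.2
  rw [← h2] at h1
  exact add_left_cancel h1

/-- The number of closing steps of a tail: one if it can be closed, none otherwise. [cite: MadrasSlade1993, Definition 1.2.4] -/
theorem card_filter_close (v : Site (d + 1)) :
    (Finset.univ.filter fun x : Idx d => v + twoStepV d x = 0).card = if (∃ x : Idx d, v + twoStepV d x = 0) then 1 else 0 := by
  split_ifs with h
  · obtain ⟨x, hx⟩ := h
    refine le_antisymm (card_filter_close_le_one v) (Finset.card_pos.2 ⟨x, Finset.mem_filter.2 ⟨Finset.mem_univ _, hx⟩⟩)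
  · rw [Finset.card_eq_zero, Finset.filter_eq_empty_iff]
    exact fun x _ hx => h ⟨x, hx⟩

/-- The tails of length 3 / 5 / 7 of a seven-letter word as finsets. [cite: MadrasSlade1993, Definition 1.2.4] -/
theorem blk7_vals : blk7 4 7 = {4, 5, 6} ∧ blk7 2 7 = {2, 3, 4, 5, 6} ∧ blk7 0 7 = Finset.univ ∧ blk7 6 7 = {6} := by
  refine ⟨by decide, by decide, by decide, by decide⟩

/-- The tail of length 3 closes iff `UnitTail3`. [cite: MadrasSlade1993, §4.2, remark after Theorem 4.2.4 (p. 94)] -/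
theorem exists_close4_iff (u : Word 7 d) : (∃ x : Idx d, bsumW u 4 7 + twoStepV d x = 0) ↔ UnitTail3 u := by
  rw [← bsum7_eq_bsumW, bsum7, exists_close_iff, blk7_vals.1]
  simp only [Finset.mem_insert, Finset.mem_singleton, exists_eq_or_imp, exists_eq_left, UnitTail3, esum7, blk7_vals.1]

/-- The tail of length 5 closes iff `UnitTail5`. [cite: MadrasSlade1993, §4.2, remark after Theorem 4.2.4 (p. 94)] -/
theorem exists_close2_iff (u : Word 7 d) : (∃ x : Idx d, bsumW u 2 7 + twoStepV d x = 0) ↔ UnitTail5 u := by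
  rw [← bsum7_eq_bsumW, bsum7, exists_close_iff, blk7_vals.2.1]
  simp only [Finset.mem_insert, Finset.mem_singleton, exists_eq_or_imp, exists_eq_left, UnitTail5, esum7, blk7_vals.2.1]

/-- The tail of length 7 closes iff `UnitTail7`. [cite: MadrasSlade1993, §4.2, remark after Theorem 4.2.4 (p. 94)] -/
theorem exists_close0_iff (u : Word 7 d) : (∃ x : Idx d, bsumW u 0 7 + twoStepV d x = 0) ↔ UnitTail7 u := by
  rw [← bsum7_eq_bsumW, bsum7, exists_close_iff, blk7_vals.2.2.1]
  simp only [Finset.mem_univ, true_and, UnitTail7, esum7, blk7_vals.2.2.1]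
  rw [Fin.exists_fin_succ, Fin.exists_fin_succ, Fin.exists_fin_succ, Fin.exists_fin_succ, Fin.exists_fin_succ, Fin.exists_fin_succ,
    Fin.exists_fin_one]
  rfl

/-- The tail of length 1 always closes (by the reversal). [cite: MadrasSlade1993, Definition 1.2.4] -/
theorem exists_close6 (u : Word 7 d) : ∃ x : Idx d, bsumW u 6 7 + twoStepV d x = 0 := by
  refine ⟨revIdx (u 6), ?_⟩
  rw [← bsum7_eq_bsumW, bsum7, blk7_vals.2.2.2, Finset.sum_singleton, twoStepV_revIdx, add_neg_cancel]

/-- Block additivity: `[i, 7) = [i, j) + [j, 7)`. [cite: MadrasSlade1993, Definition 1.2.4] -/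
theorem bsumW_split (u : Word 7 d) {i j : ℕ} (hij : i ≤ j) : bsumW u i 7 = bsumW u i j + bsumW u j 7 := by
  unfold bsumW
  rw [← Finset.sum_union]
  · refine Finset.sum_congr ?_ fun _ _ => rfl
    ext p
    simp only [Finset.mem_filter, Finset.mem_univ, true_and, Finset.mem_union]
    omega
  · rw [Finset.disjoint_filter]
    intro p _ h1 h2
    omega

/-- Two different tails of a self-avoiding word cannot both be closed by the same step. [cite: MadrasSlade1993, §4.2, remark after Theorem 4.2.4 (p. 94)] -/
theorem tail_ne_tail (u : Word 7 d) {i j : ℕ} (hij : i < j) (hblock : bsumW u i j ≠ 0) (x : Idx d)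
    (hi0 : bsumW u i 7 + twoStepV d x = 0) (hj0 : bsumW u j 7 + twoStepV d x = 0) : False := by
  apply hblock
  rw [bsumW_split u hij.le, add_assoc, hj0, add_zero] at hi0
  exact hi0

/-! ### Counting the last letter -/

open Classical in
/-- ★ THE EXTENSION COUNT for a self-avoiding seven-letter word `u`: the letters `x` with `(u, x)` self-avoiding, plus the reversal, plus
one for each closable tail, make up all `2d` letters. [cite: MadrasSlade1993, §1.2] -/
theorem card_ext_add (u : Word 7 d) (hu : SAW7 u) :
    (Finset.univ.filter fun x : Idx d => Percolation.IsSAW (Fin.snoc u x : Word 8 d)).card + 1 + (if UnitTail3 u then 1 else 0) +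
      (if UnitTail5 u then 1 else 0) + (if UnitTail7 u then 1 else 0) = 2 * d := by
  classical
  -- the four closer sets
  set E6 := Finset.univ.filter fun x : Idx d => bsumW u 6 7 + twoStepV d x = 0 with hE6
  set E4 := Finset.univ.filter fun x : Idx d => bsumW u 4 7 + twoStepV d x = 0 with hE4
  set E2 := Finset.univ.filter fun x : Idx d => bsumW u 2 7 + twoStepV d x = 0 with hE2
  set E0 := Finset.univ.filter fun x : Idx d => bsumW u 0 7 + twoStepV d x = 0 with hE0
  have c6 : E6.card = 1 := by rw [hE6, card_filter_close, if_pos (exists_close6 u)]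
  have c4 : E4.card = if UnitTail3 u then 1 else 0 := by
    rw [hE4, card_filter_close]
    by_cases hT : UnitTail3 u
    · rw [if_pos hT, if_pos ((exists_close4_iff u).2 hT)]
    · rw [if_neg hT, if_neg fun h => hT ((exists_close4_iff u).1 h)]
  have c2 : E2.card = if UnitTail5 u then 1 else 0 := by
    rw [hE2, card_filter_close]
    by_cases hT : UnitTail5 u
    · rw [if_pos hT, if_pos ((exists_close2_iff u).2 hT)]
    · rw [if_neg hT, if_neg fun h => hT ((exists_close2_iff u).1 h)]
  have c0 : E0.card = if UnitTail7 u then 1 else 0 := by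
    rw [hE0, card_filter_close]
    by_cases hT : UnitTail7 u
    · rw [if_pos hT, if_pos ((exists_close0_iff u).2 hT)]
    · rw [if_neg hT, if_neg fun h => hT ((exists_close0_iff u).1 h)]
  obtain ⟨h02, h13, h24, h35, h46, h57, h04, h15, h26, h37, h06, h17⟩ := hu
  simp only [bsum7_eq_bsumW] at h02 h24 h46 h04 h26 h06
  -- pairwise disjoint
  have d64 : Disjoint E6 E4 := Finset.disjoint_filter.2 fun x _ h6 h4 => tail_ne_tail u (by norm_num) h46 x h4 h6
  have d62 : Disjoint E6 E2 := Finset.disjoint_filter.2 fun x _ h6 h2 => tail_ne_tail u (by norm_num) h26 x h2 h6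
  have d60 : Disjoint E6 E0 := Finset.disjoint_filter.2 fun x _ h6 h0 => tail_ne_tail u (by norm_num) h06 x h0 h6
  have d42 : Disjoint E4 E2 := Finset.disjoint_filter.2 fun x _ h4 h2 => tail_ne_tail u (by norm_num) h24 x h2 h4
  have d40 : Disjoint E4 E0 := Finset.disjoint_filter.2 fun x _ h4 h0 => tail_ne_tail u (by norm_num) h04 x h0 h4
  have d20 : Disjoint E2 E0 := Finset.disjoint_filter.2 fun x _ h2 h0 => tail_ne_tail u (by norm_num) h02 x h0 h2
  -- the good letters are the complement of the union
  have hgood : (Finset.univ.filter fun x : Idx d => Percolation.IsSAW (Fin.snoc u x : Word 8 d)) = Finset.univ \ (E6 ∪ E4 ∪ E2 ∪ E0) := by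
    ext x
    simp only [Finset.mem_filter, Finset.mem_univ, true_and, Finset.mem_sdiff, Finset.mem_union, hE6, hE4, hE2, hE0, not_or,
      isSAW_snoc_iff]
    constructor
    · rintro ⟨-, t6, t4, t2, t0⟩; exact ⟨⟨⟨t6, t4⟩, t2⟩, t0⟩
    · rintro ⟨⟨⟨t6, t4⟩, t2⟩, t0⟩
      exact ⟨⟨by rwa [bsum7_eq_bsumW], h13, by rwa [bsum7_eq_bsumW], h35, by rwa [bsum7_eq_bsumW], h57, by rwa [bsum7_eq_bsumW],
        h15, by rwa [bsum7_eq_bsumW], h37, by rwa [bsum7_eq_bsumW], h17⟩, t6, t4, t2, t0⟩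
  have hU : (E6 ∪ E4 ∪ E2 ∪ E0).card = E6.card + E4.card + E2.card + E0.card := by
    rw [Finset.card_union_of_disjoint, Finset.card_union_of_disjoint, Finset.card_union_of_disjoint d64]
    · exact Finset.disjoint_union_left.2 ⟨d62, d42⟩
    · exact Finset.disjoint_union_left.2 ⟨Finset.disjoint_union_left.2 ⟨d60, d40⟩, d20⟩
  have hsub : (E6 ∪ E4 ∪ E2 ∪ E0) ⊆ Finset.univ := Finset.subset_univ _
  have := Finset.card_sdiff_add_card_eq_card hsub
  rw [← hgood, hU, c6, c4, c2, c0, Finset.card_univ, card_idx] at this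
  omega

open Classical in
/-- A non-self-avoiding prefix has no self-avoiding extension. [cite: MadrasSlade1993, §1.2] -/
theorem card_ext_of_not (u : Word 7 d) (hu : ¬ SAW7 u) :
    (Finset.univ.filter fun x : Idx d => Percolation.IsSAW (Fin.snoc u x : Word 8 d)).card = 0 := by
  rw [Finset.card_eq_zero, Finset.filter_eq_empty_iff]
  intro x _ hx
  exact hu ((isSAW_snoc_iff u x).1 hx).1

/-- Words of length 8 as (prefix, last letter). [cite: MadrasSlade1993, Definition 1.2.4] -/
def snocEquiv7 (d : ℕ) : Word 7 d × Idx d ≃ Word 8 d where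
  toFun p := Fin.snoc p.1 p.2
  invFun w := (Fin.init w, w (Fin.last 7))
  left_inv p := by
    obtain ⟨u, x⟩ := p
    simp only [Fin.init_snoc, Fin.snoc_last]
  right_inv w := Fin.snoc_init_self w

/-- ★ **THE LAST-LETTER DECOMPOSITION**: `#Percolation.sawWords d 8 + #SAW7 + #Sq + #Hx + #Oct = 2d · #SAW7`.
[cite: MadrasSlade1993, §1.2] -/
theorem card_sawWords_eight_add (d : ℕ) :
    (Percolation.sawWords d 8).card + (Finset.univ.filter fun u : Word 7 d => SAW7 u).card +
      (Finset.univ.filter fun u : Word 7 d => SAW7 u ∧ UnitTail3 u).card +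
      (Finset.univ.filter fun u : Word 7 d => SAW7 u ∧ UnitTail5 u).card +
      (Finset.univ.filter fun u : Word 7 d => SAW7 u ∧ UnitTail7 u).card =
      2 * d * (Finset.univ.filter fun u : Word 7 d => SAW7 u).card := by
  classical
  set S := Finset.univ.filter fun u : Word 7 d => SAW7 u with hS
  -- #sawWords d 8 as a sum over self-avoiding prefixes
  have e1 : (Percolation.sawWords d 8).card = (Finset.univ.filter fun w : Word 8 d => Percolation.IsSAW w).card := by
    unfold Percolation.sawWords
    congr 1
  have h8 : (Percolation.sawWords d 8).card =
      ∑ u ∈ S, (Finset.univ.filter fun x : Idx d => Percolation.IsSAW (Fin.snoc u x : Word 8 d)).card := by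
    rw [e1, card_filter_univ_equiv (snocEquiv7 d)]
    simp only [snocEquiv7, Equiv.coe_fn_mk]
    rw [Finset.card_filter, Fintype.sum_prod_type]
    dsimp only
    symm
    refine (Finset.sum_congr rfl fun u _ => Finset.card_filter _ _).trans ?_
    exact Finset.sum_subset (Finset.subset_univ S) fun u _ hu => by
      have hu' : ¬ SAW7 u := fun h => hu (Finset.mem_filter.2 ⟨Finset.mem_univ _, h⟩)
      rw [← Finset.card_filter]
      exact card_ext_of_not u hu'
  -- the three class counts and #S as sums over S
  have hq : ∀ (q : Word 7 d → Prop) [DecidablePred q],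
      (Finset.univ.filter fun u : Word 7 d => SAW7 u ∧ q u).card = ∑ u ∈ S, if q u then 1 else 0 := by
    intro q _
    rw [← Finset.card_filter, hS, Finset.filter_filter]
  have h1 : S.card = ∑ u ∈ S, 1 := by simp
  rw [h8, hq UnitTail3, hq UnitTail5, hq UnitTail7, h1, ← Finset.sum_add_distrib, ← Finset.sum_add_distrib, ← Finset.sum_add_distrib,
    ← Finset.sum_add_distrib]
  rw [show 2 * d * ∑ u ∈ S, 1 = ∑ u ∈ S, 2 * d by rw [Finset.mul_sum, mul_one]]
  refine Finset.sum_congr rfl fun u hu => ?_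
  exact card_ext_add u (Finset.mem_filter.1 hu).2

/-! ### The censuses -/

/-- The class `SAW7` counts the seven-step self-avoiding walks: `#{u : Word 7 d | SAW7 u} = count d 7`. [cite: MadrasSlade1993, §1.2] -/
theorem card_filter_saw7_eq_count (d : ℕ) : (Finset.univ.filter fun u : Word 7 d => SAW7 u).card = count d 7 := by
  classical
  rw [← card_sawWords_eq_count]
  congr 1
  ext u
  simp [Percolation.mem_sawWords, isSAW_iff_saw7]

/-- `c₇(ℤ^d)` from the tree (`…ZdEightStep` + `SAWIrreducibleBridgeSpanOne`): `count d 7 + 384d⁶ + 80d⁴ + 372d² = 128d⁷ + 352d⁵ + 192d³ + 166d`.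
[cite: MadrasSlade1993, Appendix C, Table C.1] -/
theorem count_seven_add (d : ℕ) : count d 7 + 384 * d ^ 6 + 80 * d ^ 4 + 372 * d ^ 2 = 128 * d ^ 7 + 352 * d ^ 5 + 192 * d ^ 3 + 166 * d := by
  rw [← costCoeffZd_self_succ]
  exact costCoeffZd_seven_eight_add' d

/-- ★★ **`c₈(ℤ^d)` assembled** (subtraction-free, mixed form): `count d 8 + count d 7 + SQ8 + HX8 + OCT8 = 2d · count d 7` with the three closer censuses in
falling factorials. [cite: MadrasSlade1993, Appendix C, Table C.1] -/
theorem count_eight_add_descFactorial (d : ℕ) :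
    count d 8 + count d 7 +
      (184 * d.descFactorial 2 + 1640 * d.descFactorial 3 + 2176 * d.descFactorial 4 + 736 * d.descFactorial 5 + 64 * d.descFactorial 6) +
      (60 * d.descFactorial 2 + 728 * d.descFactorial 3 + 736 * d.descFactorial 4 + 128 * d.descFactorial 5) +
      (56 * d.descFactorial 2 + 496 * d.descFactorial 3 + 432 * d.descFactorial 4) = 2 * d * count d 7 := by
  have h := card_sawWords_eight_add d
  rw [card_sawWords_eq_count, card_filter_saw7_eq_count, card_sq7, card_hx7, card_oct7] at h
  exact h

/-- ★★ **`c₈(ℤ^d) + 896d⁷ + 416d⁵ + 2124d² = 256d⁸ + 1024d⁶ + 320d⁴ + 424d³ + 1414d`** for every `d` (subtraction-free closed form).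
[cite: MadrasSlade1993, Appendix C, Table C.1] -/
theorem count_eight_add (d : ℕ) :
    count d 8 + 896 * d ^ 7 + 416 * d ^ 5 + 2124 * d ^ 2 = 256 * d ^ 8 + 1024 * d ^ 6 + 320 * d ^ 4 + 424 * d ^ 3 + 1414 * d := by
  have h := count_eight_add_descFactorial d
  have h7 := count_seven_add d
  generalize count d 8 = N at h ⊢
  generalize count d 7 = M at h h7
  rcases Nat.lt_or_ge d 7 with hd | hd
  · interval_cases d <;> simp only [Nat.descFactorial] at h <;> omega
  · obtain ⟨e, rfl⟩ := Nat.exists_eq_add_of_le' hd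
    simp only [Nat.descFactorial_succ, Nat.descFactorial_zero, mul_one] at h
    have hM : (M : ℤ) = 128 * (e + 7) ^ 7 + 352 * (e + 7) ^ 5 + 192 * (e + 7) ^ 3 + 166 * (e + 7) - 384 * (e + 7) ^ 6 - 80 * (e + 7) ^ 4 -
        372 * (e + 7) ^ 2 := by
      have := congrArg (fun m : ℕ => (m : ℤ)) h7
      push_cast at this
      linarith
    have hZ := congrArg (fun m : ℕ => (m : ℤ)) h
    push_cast at hZ ⊢
    rw [hM] at hZ
    nlinarith [hZ]

/-- ★★ **`c₈(ℤ^d) = 256d⁸ − 896d⁷ + 1024d⁶ − 416d⁵ + 320d⁴ + 424d³ − 2124d² + 1414d`** (natural subtraction, exact by `count_eight_add`).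
[cite: MadrasSlade1993, Appendix C, Table C.1] -/
theorem count_eight (d : ℕ) :
    count d 8 = 256 * d ^ 8 + 1024 * d ^ 6 + 320 * d ^ 4 + 424 * d ^ 3 + 1414 * d - 896 * d ^ 7 - 416 * d ^ 5 - 2124 * d ^ 2 := by
  have h := count_eight_add d
  omega

/-- ★★ **The cost-eight irreducible bridges of length nine**: `N_{8,9}(ℤ^{d+1}) + 896d⁷ + 416d⁵ + 2124d² = 256d⁸ + 1024d⁶ + 320d⁴ + 424d³ + 1414d`.
[cite: MadrasSlade1993, §4.2, remark after Theorem 4.2.4 (p. 94)] -/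
theorem costCoeffZd_eight_nine_add (d : ℕ) :
    costCoeffZd d 8 9 + 896 * d ^ 7 + 416 * d ^ 5 + 2124 * d ^ 2 = 256 * d ^ 8 + 1024 * d ^ 6 + 320 * d ^ 4 + 424 * d ^ 3 + 1414 * d := by
  rw [costCoeffZd_self_succ]
  exact count_eight_add d

/-- ★★ **`N_{8,9}(ℤ^{d+1}) = c₈(ℤ^d) = 256d⁸ − 896d⁷ + 1024d⁶ − 416d⁵ + 320d⁴ + 424d³ − 2124d² + 1414d`** — CONJECTURE (20) of the lane's
FINDING-PULLED-LARGE-FORCE, now a theorem. [cite: MadrasSlade1993, §4.2, remark after Theorem 4.2.4 (p. 94)] -/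
theorem costCoeffZd_eight_nine (d : ℕ) :
    costCoeffZd d 8 9 = 256 * d ^ 8 + 1024 * d ^ 6 + 320 * d ^ 4 + 424 * d ^ 3 + 1414 * d - 896 * d ^ 7 - 416 * d ^ 5 - 2124 * d ^ 2 := by
  rw [costCoeffZd_self_succ]
  exact count_eight d

/-- Lane value `d = 1`: `c₈(ℤ¹) = 2`. [cite: MadrasSlade1993, §1.2] -/
theorem count_eight_one : count 1 8 = 2 := by
  have h := count_eight_add 1
  generalize count 1 8 = N at h ⊢
  norm_num at h
  omega

/-- Lane value `d = 2`: `c₈(ℤ²) = 5 916` (locator: Table C.1). [cite: MadrasSlade1993, Appendix C, Table C.1] -/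
theorem count_eight_two : count 2 8 = 5916 := by
  have h := count_eight_add 2
  generalize count 2 8 = N at h ⊢
  norm_num at h
  omega

/-- Lane value `d = 3`: `c₈(ℤ³) = 387 966` (locator: Table C.1). [cite: MadrasSlade1993, Appendix C, Table C.1] -/
theorem count_eight_three : count 3 8 = 387966 := by
  have h := count_eight_add 3
  generalize count 3 8 = N at h ⊢
  norm_num at h
  omega

end WordTypes

end Literature.Probability.RandomPlanarGeometry.SAW.Zd

end
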